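import Literature.Algebra.EuclideanLattices.SmoothingParameterBounds
import HarnessLib

/-!
# Regev 2009, Lemma 3.5: finding the coefficients of the closest vector modulo `p` is sufficient — the recursion

Topic `Algebra/EuclideanLattices` (family `pqc`), grouping namespace `Regev2009`. Everything here is PROVED
(theorems only; no definition, no named fact).

**Lemma 3.5** (Regev, J. ACM 56 (2009) = arXiv:2401.03703, §3.2.1): *"There exists an efficient
algorithm that given a lattice `L`, a number `d < λ₁(L)/2` and an integer `p ≥ 2`, solves `CVP_{L,d}`
given access to an oracle for `CVP^{(p)}_{L,d}`"* (`CVP^{(p)}`: output `L⁻¹κ_L(x) mod p`). The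
algorithm: `x₁ = x`, `aᵢ = L⁻¹κ_L(xᵢ)`, `x_{i+1} = (xᵢ - L(aᵢ mod p))/p`; then "the closest lattice
point to `x_{i+1}` is `L(aᵢ - (aᵢ mod p))/p`", "`a_{i+1} = (aᵢ - (aᵢ mod p))/p`", the distance to the
lattice drops to `d/pⁱ`, and the coefficients are recovered backwards by `aᵢ = p a_{i+1} + (aᵢ mod p)`.
This file proves the mathematics of ONE step of that recursion for a lattice `L` with `ℤ`-basis `b`
(the machine — the loop, the final Babai call, exact arithmetic — is not formalised here); it is the
`CVP^{(p)} → CVP` half of Peikert's Prop. 3.2 / Regev's Lemma 3.4 (hypothesis `h₂` of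
`Literature.Computability.Cryptography.peikert_gapSVPZeta_to_lwe_classical_of_components`, pqc.S20;
also Regev's Thm. 3.1, pqc.S19), complementing `Cryptography/RegevBDDToLWESample.lean` (which
produces `a mod p` via the `LWE` oracle).

## Results

* `Regev2009.eq_of_norm_sub_lt_half_minNorm` (and `…_le_of_lt_half_minNorm`) — two lattice vectors
  within `< λ₁/2` of the same point coincide: `κ_L(x)` is well defined for `dist(x, L) < λ₁/2`.
* `Regev2009.coe_sub_eq_smul_and_repr` — for `κ ∈ L` with coordinates `a` and any `r ≡ a (mod p)`:
  `κ - L r = p · κ₁` with `κ₁ = L((a - r)/p) ∈ L` and `a = p · L⁻¹κ₁ + r`.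
* `Regev2009.inv_smul_sub_sub_eq`, `norm_inv_smul_sub_sub_eq` — with `x₁ = (x - L r)/p`:
  `x₁ - κ₁ = (x - κ)/p`, `‖x₁ - κ₁‖ = ‖x - κ‖/p`.
* `Regev2009.norm_next_lt_half_minNorm` — the invariant `‖x₁ - κ₁‖ < λ₁/2` (so `κ₁ = κ_L(x₁)`).
* `Regev2009.dvd_repr_sub_val` — `r = (a mod p)` via `ZMod.val` satisfies `p ∣ aᵢ - rᵢ`.

## References

* O. Regev, *On lattices, learning with errors, random linear codes, and cryptography*, J. ACM 56
  (2009), art. 34 = arXiv:2401.03703, Lemma 3.5 and its proof (§3.2.1) [RegevLWE2009] (held; chunk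
  p0016).
-/

noncomputable section

open Module

namespace Literature.Algebra.EuclideanLattices

namespace Regev2009

section Unique

variable {E : Type*} [NormedAddCommGroup E]

/-- **Uniqueness of the closest vector below half the minimum distance**: two lattice vectors both
within distance `< λ₁(L)/2` of the same point coincide (their difference is a lattice vector of norm
`< λ₁`). This is why `CVP_{L,d}` with `d < λ₁(L)/2` (Regev 2009, §3.2.1: "for some
`0 < d < λ₁(L)/2` … `κ_L(x)`, the closest vector") has a well-defined answer. [cite: RegevLWE2009, §3.2.1 (before Lemma 3.5)] -/
theorem eq_of_norm_sub_lt_half_minNorm (L : Submodule ℤ E) {x κ κ' : E} (hκ : κ ∈ L) (hκ' : κ' ∈ L)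
    (h : ‖x - κ‖ < minNorm L / 2) (h' : ‖x - κ'‖ < minNorm L / 2) : κ = κ' := by
  by_contra hne
  have hmem : κ' - κ ∈ L := sub_mem hκ' hκ
  have hne0 : κ' - κ ≠ 0 := sub_ne_zero.2 (Ne.symm hne)
  have hmin : minNorm L ≤ ‖κ' - κ‖ := minNorm_le_norm_of_mem_of_ne_zero L hmem hne0
  have htri : ‖κ' - κ‖ ≤ ‖x - κ‖ + ‖x - κ'‖ := by
    rw [show κ' - κ = (x - κ) - (x - κ') by abel]
    exact norm_sub_le _ _
  linarith

/-- Variant: if `κ ∈ L` is within `< λ₁/2` of `x`, every lattice vector at least as close to `x` is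
`κ` (so `κ` is THE closest vector, `κ_L(x)`). [cite: RegevLWE2009, §3.2.1 (before Lemma 3.5)] -/
theorem eq_of_norm_sub_le_of_lt_half_minNorm (L : Submodule ℤ E) {x κ κ' : E} (hκ : κ ∈ L)
    (hκ' : κ' ∈ L) (h : ‖x - κ‖ < minNorm L / 2) (h' : ‖x - κ'‖ ≤ ‖x - κ‖) : κ' = κ :=
  (eq_of_norm_sub_lt_half_minNorm L hκ hκ' h (h'.trans_lt h)).symm

end Unique

section Digits

variable {E : Type*} [NormedAddCommGroup E] [NormedSpace ℝ E]
variable {L : Submodule ℤ E} {ι : Type*} [Fintype ι] (b : Basis ι ℤ L) (p : ℕ) [NeZero p]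

omit [NormedSpace ℝ E] in
/-- Coordinates of `b.equivFun.symm r`: the lattice vector `L r = ∑ rᵢ bᵢ` has `b`-coordinates `r`.
[folklore] -/
theorem repr_equivFun_symm (r : ι → ℤ) (i : ι) : b.repr (b.equivFun.symm r) i = r i := by
  rw [← Basis.equivFun_apply, LinearEquiv.apply_symm_apply]

omit [NeZero p] in
/-- **The digit step of Regev's Lemma 3.5.** Let `κ ∈ L` have `b`-coordinates `a = L⁻¹κ` and let
`r ∈ ℤⁿ` represent `a mod p` (`p ∣ aᵢ - rᵢ`; e.g. `r = a mod p` from the `CVP^{(p)}` oracle). Then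
`κ - L r = p · κ₁` for the lattice vector `κ₁ = L((a - r)/p)`, whose coordinates satisfy
`a = p · L⁻¹κ₁ + r` ("`a_{i+1} = (aᵢ - (aᵢ mod p))/p`" and, read backwards, "`aᵢ = p a_{i+1} + (aᵢ mod p)`").
[cite: RegevLWE2009, Lemma 3.5 (proof)] -/
theorem coe_sub_eq_smul_and_repr (κ : L) (r : ι → ℤ) (hr : ∀ i, (p : ℤ) ∣ b.repr κ i - r i) :
    (κ : E) - (b.equivFun.symm r : E) =
        (p : ℝ) • ((b.equivFun.symm fun i => (b.repr κ i - r i) / p : L) : E) ∧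
      ∀ i, b.repr κ i = p * b.repr (b.equivFun.symm fun i => (b.repr κ i - r i) / p) i + r i := by
  set κ₁ : L := b.equivFun.symm fun i => (b.repr κ i - r i) / p with hκ₁
  have hrepr : ∀ i, b.repr κ₁ i = (b.repr κ i - r i) / p := fun i => repr_equivFun_symm b _ i
  have hdiv : ∀ i, (p : ℤ) * ((b.repr κ i - r i) / p) = b.repr κ i - r i := fun i =>
    Int.mul_ediv_cancel' (hr i)
  -- the identity in `L`, by comparing coordinates
  have hL : κ - b.equivFun.symm r = (p : ℤ) • κ₁ := by
    apply b.repr.injective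
    ext i
    rw [map_sub, Finsupp.sub_apply, repr_equivFun_symm, map_zsmul, Finsupp.smul_apply, smul_eq_mul,
      hrepr, hdiv]
  refine ⟨?_, fun i => ?_⟩
  · have h := congrArg (fun w : L => (w : E)) hL
    simp only [Submodule.coe_sub, Submodule.coe_smul_of_tower] at h
    rw [h, ← Int.cast_smul_eq_zsmul ℝ, Int.cast_natCast]
  · rw [hrepr, hdiv, sub_add_cancel]

/-- **The distance shrinks by `p`** (Regev 2009, Lemma 3.5: "`x_{i+1} = (xᵢ - L(aᵢ mod p))/p` … the
closest lattice point to `x_{i+1}` is `L(aᵢ - (aᵢ mod p))/p` … the distance of `x_{i+1}` from `L` is at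
most `d/pⁱ`"): with `x₁ = p⁻¹(x - L r)` and `κ₁` as above, `x₁ - κ₁ = p⁻¹(x - κ)`, so
`‖x₁ - κ₁‖ = ‖x - κ‖/p`. [cite: RegevLWE2009, Lemma 3.5 (proof)] -/
theorem inv_smul_sub_sub_eq (x : E) (κ : L) (r : ι → ℤ) (hr : ∀ i, (p : ℤ) ∣ b.repr κ i - r i) :
    (p : ℝ)⁻¹ • (x - (b.equivFun.symm r : E)) -
        ((b.equivFun.symm fun i => (b.repr κ i - r i) / p : L) : E) =
      (p : ℝ)⁻¹ • (x - (κ : E)) := by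
  have hp : (p : ℝ) ≠ 0 := NeZero.ne (p : ℝ)
  obtain ⟨h, -⟩ := coe_sub_eq_smul_and_repr b p κ r hr
  -- `L r = κ - p κ₁`
  have h' : (b.equivFun.symm r : E) =
      (κ : E) - (p : ℝ) • ((b.equivFun.symm fun i => (b.repr κ i - r i) / p : L) : E) := by
    rw [← h, sub_sub_cancel]
  rw [h', smul_sub, smul_sub, smul_sub, smul_smul, inv_mul_cancel₀ hp, one_smul]
  abel

/-- The norm form: `‖x₁ - κ₁‖ = ‖x - κ‖/p`. [cite: RegevLWE2009, Lemma 3.5 (proof)] -/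
theorem norm_inv_smul_sub_sub_eq (x : E) (κ : L) (r : ι → ℤ) (hr : ∀ i, (p : ℤ) ∣ b.repr κ i - r i) :
    ‖(p : ℝ)⁻¹ • (x - (b.equivFun.symm r : E)) -
        ((b.equivFun.symm fun i => (b.repr κ i - r i) / p : L) : E)‖ = ‖x - (κ : E)‖ / p := by
  rw [inv_smul_sub_sub_eq b p x κ r hr, norm_smul, norm_inv, Real.norm_natCast, inv_mul_eq_div]

/-- **The invariant of the recursion**: if `κ` is within `< λ₁(L)/2` of `x` then `κ₁` is within
`< λ₁(L)/2` of `x₁` (indeed within `‖x - κ‖/p ≤ ‖x - κ‖`), so `κ₁ = κ_L(x₁)` is again the unique closest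
vector and the `CVP^{(p)}` oracle may be called on `x₁`. [cite: RegevLWE2009, Lemma 3.5 (proof)] -/
theorem norm_next_lt_half_minNorm {x : E} {κ : L} (hx : ‖x - (κ : E)‖ < minNorm L / 2) (r : ι → ℤ)
    (hr : ∀ i, (p : ℤ) ∣ b.repr κ i - r i) :
    ‖(p : ℝ)⁻¹ • (x - (b.equivFun.symm r : E)) -
        ((b.equivFun.symm fun i => (b.repr κ i - r i) / p : L) : E)‖ < minNorm L / 2 := by
  rw [norm_inv_smul_sub_sub_eq b p x κ r hr]
  have hp1 : (1 : ℝ) ≤ p := Nat.one_le_cast.2 (Nat.pos_of_ne_zero (NeZero.ne p))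
  exact (div_le_self (norm_nonneg _) hp1).trans_lt hx

omit [NormedSpace ℝ E] [Fintype ι] in
/-- The hypothesis `p ∣ aᵢ - rᵢ` for the canonical representative: `r = (a mod p)` read through
`ZMod.val` (what a `CVP^{(p)}` oracle returning `L⁻¹κ mod p ∈ ℤ_pⁿ` provides). [folklore] -/
theorem dvd_repr_sub_val (κ : L) (i : ι) :
    (p : ℤ) ∣ b.repr κ i - (((b.repr κ i : ZMod p)).val : ℤ) := by
  rw [← ZMod.intCast_eq_intCast_iff_dvd_sub, ZMod.natCast_val, ZMod.intCast_cast, ZMod.cast_intCast']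

end Digits

end Regev2009

end Literature.Algebra.EuclideanLattices
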